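import Summits.Parity.GeneralizedHardyLittlewood.Theorems.PrimeLevelFamEdgeMomentsBeyondDiagonalDiagRemDeformedLocalSum
import Summits.Parity.GeneralizedHardyLittlewood.Theorems.PrimeLevelFamEdgeMomentsBeyondDiagonalDiagRemDeformedKernel
import Summits.Parity.GeneralizedHardyLittlewood.Theorems.PrimeLevelFamEdgeMomentsBeyondDiagonalDiagRemConvTailPow
import HarnessLib

/-!
# Route `PrimeLevelFamEdge`, crux K_A `MomentsBeyondDiagonal` (stmt-Parity-20007), line «petersson_layers» v4, stub `stub_diag`:
# **«D4TAIL»_A PROVED — `Σ_{k ≤ y} a_n(k)D₄(k) = c_n + O_A(D(n)(1 + log y)⁻ᴬ)`** (the ONE analytic input that was missing for the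
# order-`(4,4)` remainder estimate (R₄₄), i.e. for RUNG 4 of `stub_diag`)

`a_n = copTauW n = 1_{(·,n)=1}τW` (the Selberg coefficients of the `X²` kernel form), `D₄(k) = 3P₂(k)² − 2P₄(k)`, `P_j(k) = Σ_{p∣k}logʲp`,
`D(n) = Σ_{d∣n} d^{−3/4}`. This is VERBATIM the hypothesis `hD4` of `…DiagRemBothSidedDecorFour.abs_bothsided_decorFour_decorFour_le_pow_of`
(p839970), for every saving exponent `A`; with it the `D₄ ⊗ D₄` both-sided monomial of (R₄₄) is unconditional.

Proof = the `t`-deformation route of this lineage (g17), assembled: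
`…DiagRemDeformedIdentity` (`Σ_{k≤N} a_nD₄ = Σ_m Σ_i C(4,i) η_n^{(4−i)}(m) Σ_{j ≤ N/m} β_i(j)`, from `GE ∗ AE = δ` in `ArithmeticFunction ℝ⟦X⟧`
and the Rademacher identity `…DiagRemRademacher`), `…DiagRemDeformedKernel` (`Σ_{j ≤ z} β_i(j) = κ_i + O((1+log z)⁻ᴬ)`, from
`…DiagRemMoebiusLogPow` + `…DiagRemHyperbolaProduct`), `…DiagRemDeformedLocalSum` (`Σ_m|η_n^{(c)}(m)|m^{1/16} ≤ C_c D(n)`) and the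
abstract tail lemma `…DiagRemConvTailPow.exists_convTail_const`. No individually divergent Möbius sum (`Σμ(d)P₄(d)/d`, `Σμ(d)P₂(d)²/d`)
appears anywhere.

* `abs_sum_copTauW_decorFour_sub_le_pow` — **(«D4TAIL»_A) for every `A` there is `C_A ≥ 0` such that for every `n ≥ 1` there is `c_n`
  (`= Σ_i C(4,i)κ_iΣ_mη_n^{(4−i)}(m)`, the same for every `A`, `|c_n| ≤ C_A·D(n)`) with
  `|Σ_{k ≤ y} a_n(k)D₄(k) − c_n| ≤ C_A·D(n)/(1 + log y)ᴬ` for all `y ≥ 1`.**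

Def-free; theorems only. Helper `--supports stmt-Parity-20007`; closes nothing by itself (it discharges `hD4` of p839970; the
remaining steps to RUNG 4 are the inner/estimate templating listed in `Cruxes/…/Lines/petersson_layers_stub_diag_g16_order44.md`);
K_A, K_B and the Parity summit are NOT proved; nothing about Landau–Siegel zeros.

## References
* E. Kowalski, P. Michel, J. VanderKam, J. reine angew. Math. 526 (2000), Prop. 5.1 p. 18.
  [cite: KowalskiMichelVanderKam2000, Prop. 5.1 — derivation (D₄-twisted Selberg coefficients)]
* H. L. Montgomery, R. C. Vaughan, *Multiplicative Number Theory I*, CUP 2007, §2.1, §8.1.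
  [cite: MontgomeryVaughan2007, §8.1 — derivation]
-/

noncomputable section

open Finset Real ArithmeticFunction

namespace Summit.Parity.GeneralizedHardyLittlewood.Theorems.MomentsBeyondDiagonal.DiagCorner

open Literature.NumberTheory.LFunctions.KMV2000.MollifierMainTerm (W G)
open Summit.Parity.GeneralizedHardyLittlewood.Theorems.BeyondDiagonalBeatsQuarter.KernelFormXSq
  (copTauW divWeight divWeight_nonneg)

set_option maxHeartbeats 1600000 in
/-- **(«D4TAIL»_A).** For every `A` there is `C_A ≥ 0` such that for every `n ≥ 1` there is `c_n` with `|c_n| ≤ C_A·D(n)` and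
`|Σ_{k ≤ y} a_n(k)(3P₂(k)² − 2P₄(k)) − c_n| ≤ C_A·D(n)/(1 + log y)ᴬ` for all `y ≥ 1` — verbatim the hypothesis `hD4` of
`…DiagRemBothSidedDecorFour.abs_bothsided_decorFour_decorFour_le_pow_of`.
[cite: KowalskiMichelVanderKam2000, Prop. 5.1 — derivation (D₄-twisted Selberg coefficients)] -/
theorem abs_sum_copTauW_decorFour_sub_le_pow (A : ℕ) :
    ∃ C : ℝ, 0 ≤ C ∧ ∀ n : ℕ, n ≠ 0 → ∃ c : ℝ, |c| ≤ C * divWeight n ∧ ∀ y : ℝ, 1 ≤ y →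
      |(∑ k ∈ Icc 1 ⌊y⌋₊, copTauW n k *
          (3 * (∑ p ∈ k.primeFactors, Real.log p ^ 2) ^ 2 - 2 * ∑ p ∈ k.primeFactors, Real.log p ^ 4)) - c| ≤
        C * divWeight n / (1 + Real.log y) ^ A := by
  classical
  -- inputs
  obtain ⟨CT, hCT0, hCT⟩ := exists_convTail_const A
  have hker := fun i : ℕ ↦ exists_abs_sum_G_logDiff_kernel_sub_le_pow i
  choose κ hκ using hker
  have hkerA := fun i : ℕ ↦ hκ i A
  choose K hK0 hK using hkerA
  have hloc := fun c : ℕ ↦ exists_summable_abs_eta_mul_rpow c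
  choose Cη hCη0 hCη using hloc
  -- the constant
  set C : ℝ := ∑ i ∈ Finset.range 5, (Nat.choose 4 i : ℝ) * ((CT + 1) * (K i + |κ i|) * Cη (4 - i)) with hCdef
  have hC0 : 0 ≤ C := Finset.sum_nonneg fun i _ ↦ by
    have := hK0 i; have := hCη0 (4 - i); positivity
  refine ⟨C, hC0, fun n hn ↦ ?_⟩
  set D : ℝ := divWeight n with hDdef
  have hD0 : 0 ≤ D := divWeight_nonneg n
  -- the local factors `η^{(c)}` and their data
  set η : ℕ → ℕ → ℝ := fun c m ↦ ∑ y ∈ m.divisorsAntidiagonal, ∑ x ∈ y.1.divisorsAntidiagonal,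
      ∑ z ∈ y.2.divisorsAntidiagonal,
        (x.1 : ℝ)⁻¹ * (x.2 : ℝ)⁻¹ * (if y.2.Coprime n then W y.2 else 0) *
          (Real.log x.1 - Real.log x.2 + (Real.log z.1 - Real.log z.2)) ^ c with hηdef
  have hη0 : ∀ c, η c 0 = 0 := fun c ↦ by simp [hηdef]
  have hηs : ∀ c, Summable fun m : ℕ ↦ |η c m| * (m : ℝ) ^ (1 / 16 : ℝ) := fun c ↦ (hCη c n hn).1
  have hηM : ∀ c, ∑' m : ℕ, |η c m| * (m : ℝ) ^ (1 / 16 : ℝ) ≤ Cη c * D := fun c ↦ (hCη c n hn).2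
  have hηabs : ∀ c, Summable fun m : ℕ ↦ |η c m| := fun c ↦ summable_abs_of_summable_abs_mul_rpow (hη0 c) (hηs c)
  have hηtsum : ∀ c, |∑' m : ℕ, η c m| ≤ Cη c * D := by
    intro c
    calc |∑' m : ℕ, η c m| ≤ ∑' m : ℕ, |η c m| := by
          have := norm_tsum_le_tsum_norm (f := fun m : ℕ ↦ η c m) (by simpa [Real.norm_eq_abs] using hηabs c)
          simpa [Real.norm_eq_abs] using this
      _ ≤ ∑' m : ℕ, |η c m| * (m : ℝ) ^ (1 / 16 : ℝ) := by
          refine (hηabs c).tsum_le_tsum (fun m ↦ ?_) (hηs c)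
          rcases Nat.eq_zero_or_pos m with rfl | hm
          · simp [hη0 c]
          · exact le_mul_of_one_le_right (abs_nonneg _) (Real.one_le_rpow (by exact_mod_cast hm) (by norm_num))
      _ ≤ Cη c * D := hηM c
  -- the kernels `β_i`
  set β : ℕ → ℕ → ℝ := fun i j ↦ ∑ x ∈ j.divisorsAntidiagonal, G x.1 * G x.2 * (Real.log x.1 - Real.log x.2) ^ i with hβdef
  -- the constant `c_n`
  refine ⟨∑ i ∈ Finset.range 5, (Nat.choose 4 i : ℝ) * (κ i * ∑' m : ℕ, η (4 - i) m), ?_, fun y hy ↦ ?_⟩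
  · -- `|c_n| ≤ C·D`
    calc |∑ i ∈ Finset.range 5, (Nat.choose 4 i : ℝ) * (κ i * ∑' m : ℕ, η (4 - i) m)|
        ≤ ∑ i ∈ Finset.range 5, |(Nat.choose 4 i : ℝ) * (κ i * ∑' m : ℕ, η (4 - i) m)| := Finset.abs_sum_le_sum_abs _ _
      _ ≤ ∑ i ∈ Finset.range 5, (Nat.choose 4 i : ℝ) * ((CT + 1) * (K i + |κ i|) * Cη (4 - i)) * D := by
          refine Finset.sum_le_sum fun i _ ↦ ?_
          rw [abs_mul, abs_mul, Nat.abs_cast]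
          have h1 : |κ i| * |∑' m : ℕ, η (4 - i) m| ≤ |κ i| * (Cη (4 - i) * D) :=
            mul_le_mul_of_nonneg_left (hηtsum (4 - i)) (abs_nonneg _)
          have h2 : |κ i| * (Cη (4 - i) * D) ≤ ((CT + 1) * (K i + |κ i|) * Cη (4 - i)) * D := by
            have hK := hK0 i; have hCη' := hCη0 (4 - i)
            have : |κ i| ≤ (CT + 1) * (K i + |κ i|) := by nlinarith [abs_nonneg (κ i)]
            nlinarith [abs_nonneg (κ i), mul_nonneg hCη' hD0]
          calc (Nat.choose 4 i : ℝ) * (|κ i| * |∑' m : ℕ, η (4 - i) m|)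
              ≤ (Nat.choose 4 i : ℝ) * (((CT + 1) * (K i + |κ i|) * Cη (4 - i)) * D) :=
                mul_le_mul_of_nonneg_left (h1.trans h2) (Nat.cast_nonneg _)
            _ = _ := by ring
      _ = C * D := by rw [hCdef, Finset.sum_mul]
  · -- the tail estimate
    have hy0 : 0 < y := by linarith
    have hL : 0 < (1 + Real.log y) ^ A := pow_pos (by linarith [Real.log_nonneg hy]) A
    rw [sum_copTauW_decorFour_eq_deformed n ⌊y⌋₊]
    -- rewrite the identity's right-hand side with `η`, `β` and swap the sums
    have hre : (∑ m ∈ Icc 1 ⌊y⌋₊, ∑ i ∈ Finset.range 5, (Nat.choose 4 i : ℝ) * η (4 - i) m *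
        ∑ j ∈ Icc 1 (⌊y⌋₊ / m), β i j) =
        ∑ i ∈ Finset.range 5, (Nat.choose 4 i : ℝ) * ∑ m ∈ Icc 1 ⌊y⌋₊, η (4 - i) m * ∑ j ∈ Icc 1 (⌊y⌋₊ / m), β i j := by
      rw [Finset.sum_comm]
      refine Finset.sum_congr rfl fun i _ ↦ ?_
      rw [Finset.mul_sum]
      exact Finset.sum_congr rfl fun m _ ↦ by ring
    rw [show (∑ m ∈ Icc 1 ⌊y⌋₊, ∑ i ∈ Finset.range 5, (Nat.choose 4 i : ℝ) *
        (∑ y ∈ m.divisorsAntidiagonal, ∑ x ∈ y.1.divisorsAntidiagonal, ∑ z ∈ y.2.divisorsAntidiagonal,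
          (x.1 : ℝ)⁻¹ * (x.2 : ℝ)⁻¹ * (if y.2.Coprime n then W y.2 else 0) *
            (Real.log x.1 - Real.log x.2 + (Real.log z.1 - Real.log z.2)) ^ (4 - i)) *
        ∑ j ∈ Icc 1 (⌊y⌋₊ / m), ∑ x ∈ j.divisorsAntidiagonal,
          G x.1 * G x.2 * (Real.log x.1 - Real.log x.2) ^ i) =
        ∑ m ∈ Icc 1 ⌊y⌋₊, ∑ i ∈ Finset.range 5, (Nat.choose 4 i : ℝ) * η (4 - i) m * ∑ j ∈ Icc 1 (⌊y⌋₊ / m), β i j from rfl,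
      hre, ← Finset.sum_sub_distrib]
    -- termwise: the abstract convolution tail
    have hterm : ∀ i ∈ Finset.range 5,
        |(Nat.choose 4 i : ℝ) * ∑ m ∈ Icc 1 ⌊y⌋₊, η (4 - i) m * ∑ j ∈ Icc 1 (⌊y⌋₊ / m), β i j -
          (Nat.choose 4 i : ℝ) * (κ i * ∑' m : ℕ, η (4 - i) m)| ≤
        (Nat.choose 4 i : ℝ) * (((CT + 1) * (K i + |κ i|) * Cη (4 - i)) * D / (1 + Real.log y) ^ A) := by
      intro i _
      have h := hCT (β i) (η (4 - i)) (κ i) (K i) (Cη (4 - i) * D) (hK0 i) (hK i) (hη0 _) (hηs _) (hηM _) y hy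
      rw [← mul_sub, abs_mul, Nat.abs_cast]
      refine mul_le_mul_of_nonneg_left (h.trans ?_) (Nat.cast_nonneg _)
      rw [div_le_div_iff_of_pos_right hL]
      have hK := hK0 i; have hCη' := hCη0 (4 - i)
      have h3 : 0 ≤ (K i + |κ i|) * (Cη (4 - i) * D) := by positivity
      nlinarith
    calc |∑ i ∈ Finset.range 5, ((Nat.choose 4 i : ℝ) * ∑ m ∈ Icc 1 ⌊y⌋₊, η (4 - i) m * ∑ j ∈ Icc 1 (⌊y⌋₊ / m), β i j -
          (Nat.choose 4 i : ℝ) * (κ i * ∑' m : ℕ, η (4 - i) m))|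
        ≤ ∑ i ∈ Finset.range 5, |(Nat.choose 4 i : ℝ) * ∑ m ∈ Icc 1 ⌊y⌋₊, η (4 - i) m * ∑ j ∈ Icc 1 (⌊y⌋₊ / m), β i j -
          (Nat.choose 4 i : ℝ) * (κ i * ∑' m : ℕ, η (4 - i) m)| := Finset.abs_sum_le_sum_abs _ _
      _ ≤ ∑ i ∈ Finset.range 5, (Nat.choose 4 i : ℝ) * (((CT + 1) * (K i + |κ i|) * Cη (4 - i)) * D / (1 + Real.log y) ^ A) :=
          Finset.sum_le_sum hterm
      _ = C * D / (1 + Real.log y) ^ A := by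
          rw [hCdef, Finset.sum_mul, Finset.sum_div]
          exact Finset.sum_congr rfl fun i _ ↦ by ring

end Summit.Parity.GeneralizedHardyLittlewood.Theorems.MomentsBeyondDiagonal.DiagCorner

end
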